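import Summits.QuantumFields.BalabanUV.T4Continuum.Support.DirichletSplitPieces

/-!
# `BalabanUV.T4Continuum.Support.DirichletSplitVertex` — NE2 (node U1a) formalisation swarm, SUPPLIER item «Δ1-LOCAL» under the owner's
# sub-row `T4-U1a.S-NE2-D1-DIRICHLET°` (wall `hinj`): ONE VERTEX — admissibility of the two pieces, the finite-overlap lemma, and the
# per-vertex one-sided Besov estimate (unit b2b-balaban-t4-ne2-formalise-leaf-08, gen 5, file 2 of 4)

HONEST FRAMING.  Rung (B)+1 bookkeeping at MODEL level (U = 1 scalar layer), finite torus; NE2 (U1a) is NOT proved by this file; spine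
PROVED 0/9 unchanged; NOT infinite volume, NOT the mass gap, NOT Clay.  HONEST DEPENDENCY (verbatim): «continuum YM on T⁴ ⇐ BetaPertH ∧
nine spine estimates (0/9 proved); BetaPertH ⇐ (D1) ∧ (D4) ∧ CAP+tail; G-an2-4 gates asym, D1 and NE2/3/4.»

WHAT THIS FILE PROVES (0 sorry; file 1 `DirichletSplitPieces` and gen 3's module (I) BY NAME).
 * §1 ADMISSIBILITY: `T_{+e_μ}(piece flagD f_v) − piece flagD f_v` vanishes off the `flagD`-blocks (down-closedness of `S ⊓ σ` + the bump
   of `v` vanishes on the first `μ`-layer of a lower block), `T_{−e_μ}(piece flagU f_v) − piece flagU f_v` vanishes off the `flagU`-blocks;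
 * §2 FINITE OVERLAP `‖Σ_i g_i‖² ≤ K·Σ_i‖g_i‖²` when at most `K` members are non-zero at any point, and `Σ√a√b ≤ √Σa·√Σb`;
 * §3 the `≤ 2^d` vertices of a block (`patchVerts`), the `≤ 3·2^d` vertices seen by a second difference at a site (`tripleVerts`);
 * §4 **ONE VERTEX**: `SplittableAt S v μ → ‖∂_μ∂_μ (bump_v·z)‖² ≤ 8‖c‖·√E(bump_v·z)·‖1_ΩΔ(bump_v·z)‖` for every `z` supported in
   `Ω ↔ blockReg n M S` — module (I)'s MAIN LEMMA `DirichletDirectionalBesov.nsq_sdiff_sdiff_le_of_admissible` applied to each piece on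
   its own blocks, the piece's gradient ∕ compressed Laplacian dominated by those of `bump_v·z` (file 1 §2).

ABSOLUTE RULE (cell, verbatim): «No internally-minted statement may enter as a cited fact. Every hypothesis is either kernel-proved in
this package or a verbatim quotation of a PUBLISHED theorem with page reference. The manuscript(s) under audit are NOT citable for
their own disputed steps — they are the thing under adjudication; programme-internal (2001/route/tribunal) claims are never citable.»
[folklore] finite lattice calculus; no `def … : Prop` fact.  NOT CLAIMED: non-splittable patches (the spiral 4-chain); the VECTOR operator;
rate `L^{−1}`; NE2; NE3; «not in print; our proof».
-/

noncomputable section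

open scoped BigOperators ComplexConjugate Matrix
open Finset

namespace Summit.QuantumFields.BalabanUV.T4Continuum.DirichletSplitVertex

open Literature.MathematicalPhysics.QuantumFieldTheory.Balaban1983to89.B5Prop11Plancherel (Tor fine unitVec)
open Literature.MathematicalPhysics.QuantumFieldTheory.Balaban1983to89.B5Action121 (sdiff LapS sdiff_mulVec LapS_mulVec)
open Literature.MathematicalPhysics.QuantumFieldTheory.Balaban1983to89.B5Prop11Lower (nsq nsq_nonneg)
open Literature.MathematicalPhysics.QuantumFieldTheory.Balaban1983to89.B5Blocks16 (blockOf)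
open Summit.QuantumFields.BalabanUV.T4Continuum.ScalarBlockPoincare (nsq_add_le nsq_smul transS nsq_transS)
open Summit.QuantumFields.BalabanUV.T4Continuum.DirichletDirectionalBesov (nsq_mono nsqOn nsqOn_nonneg restrictTo nsq_restrictTo
  nsq_sdiff_sdiff_le_of_admissible)
open Summit.QuantumFields.BalabanUV.T4Continuum.DirichletDirectionalBesovCutoff (cut energy energy_nonneg)
open Summit.QuantumFields.BalabanUV.T4Continuum.DirichletMonotoneCutoff (rampUp_zero rampDn_last offsF blockOf_offsF_add_of_lt
  blockOf_offsF_add_of_eq blockOf_offsF_sub bump axisF_ne_zero axisF_ne_zero_of_bump_ne_zero inPatch_of_bump_ne_zero InPatch DownClosed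
  UpClosed)
open Summit.QuantumFields.BalabanUV.T4Continuum.DirichletSplitPieces (SplittableAt piece flagD flagU vfield piece_apply_of_pos
  piece_apply_of_neg piece_add_piece mem_of_vfield_ne_zero bump_ne_zero_of_vfield_ne_zero inPatch_sub_of_upper inPatch_add_of_lower
  Propagates propagates_flagD propagates_flagU norm_sdiff_piece_le LapS_piece_eq)

variable {d : ℕ}

/-! ## §1 Admissibility of the two pieces -/

section Admissible

variable (n : ℕ) [NeZero n] (M : Fin d → ℕ) [hM : ∀ μ, NeZero (M μ)]

/-- the bump of `v` vanishes on the FIRST `μ`-layer of a block unless the block is UPPER along `μ` in the patch of `v`. [folklore] -/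
theorem upper_of_bump_ne_zero_of_offs_zero {v : Tor M} {x : Tor (fine n M)} {μ : Fin d} (hb : bump n M v x ≠ 0)
    (h0 : (offsF n M x μ : ℕ) = 0) : v μ = blockOf n M x μ := by
  rcases axisF_ne_zero n (axisF_ne_zero_of_bump_ne_zero n M hb μ) with ⟨-, hu⟩ | ⟨h2, -⟩
  · rw [h0, rampUp_zero] at hu; exact absurd rfl hu
  · exact h2

/-- the bump of `v` vanishes on the LAST `μ`-layer of a block unless the block is LOWER along `μ` (`2 ≤ n`). [folklore] -/
theorem lower_of_bump_ne_zero_of_offs_last (hn : 2 ≤ n) {v : Tor M} {x : Tor (fine n M)} {μ : Fin d} (hb : bump n M v x ≠ 0)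
    (hl : (offsF n M x μ : ℕ) + 1 = n) : v μ = blockOf n M x μ + 1 := by
  rcases axisF_ne_zero n (axisF_ne_zero_of_bump_ne_zero n M hb μ) with ⟨h1, -⟩ | ⟨-, hd⟩
  · exact h1
  · rw [show (offsF n M x μ : ℕ) = n - 1 by omega, rampDn_last hn] at hd; exact absurd rfl hd

/-- **ADMISSIBILITY OF THE DOWN PIECE**: `T_{+e_μ}(piece flagD f_v) − piece flagD f_v` vanishes off the `flagD`-blocks. [folklore] -/
theorem admissible_pieceD {S σ : Tor M → Prop} {v : Tor M} {μ : Fin d} (hD : DownClosed M (fun b => S b ∧ σ b) v μ)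
    (z : Tor (fine n M) → ℂ) :
    ∀ x, ¬ flagD M S σ v (blockOf n M x) →
      (transS (fine n M) (unitVec (fine n M) μ) (piece n M (flagD M S σ v) (vfield n M v z))
        - piece n M (flagD M S σ v) (vfield n M v z)) x = 0 := by
  intro x hx
  rw [Pi.sub_apply, transS, piece_apply_of_neg n M _ hx, sub_zero]
  set y := x + unitVec (fine n M) μ with hy
  by_cases hyD : flagD M S σ v (blockOf n M y)
  · rw [piece_apply_of_pos n M _ hyD]
    -- `x = y − e_μ` lies in the block of `y` (contradiction) or in the block below, with `y` on the first `μ`-layer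
    have hxy : x = y - unitVec (fine n M) μ := by rw [hy, add_sub_cancel_right]
    rcases blockOf_offsF_sub n M y μ with ⟨-, hb, -, -⟩ | ⟨h0, hb, -, -⟩
    · rw [← hxy] at hb; exact absurd (hb ▸ hyD) hx
    · rw [← hxy] at hb
      by_contra hf
      have hbump := bump_ne_zero_of_vfield_ne_zero n M hf
      have hu := upper_of_bump_ne_zero_of_offs_zero n M hbump h0
      obtain ⟨hS', hσ'⟩ := hD _ hyD.1 hu ⟨hyD.2.1, hyD.2.2⟩
      exact hx (hb ▸ ⟨inPatch_sub_of_upper M hyD.1 hu, hS', hσ'⟩)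
  · rw [piece_apply_of_neg n M _ hyD]

/-- **ADMISSIBILITY OF THE UP PIECE**: `T_{−e_μ}(piece flagU f_v) − piece flagU f_v` vanishes off the `flagU`-blocks (`2 ≤ n`).
[folklore] -/
theorem admissible_pieceU (hn : 2 ≤ n) {S σ : Tor M → Prop} {v : Tor M} {μ : Fin d} (hU : UpClosed M (fun b => S b ∧ ¬ σ b) v μ)
    (z : Tor (fine n M) → ℂ) :
    ∀ x, ¬ flagU M S σ v (blockOf n M x) →
      (transS (fine n M) (-unitVec (fine n M) μ) (piece n M (flagU M S σ v) (vfield n M v z))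
        - piece n M (flagU M S σ v) (vfield n M v z)) x = 0 := by
  intro x hx
  rw [Pi.sub_apply, transS, piece_apply_of_neg n M _ hx, sub_zero, ← sub_eq_add_neg]
  set y := x - unitVec (fine n M) μ with hy
  by_cases hyU : flagU M S σ v (blockOf n M y)
  · rw [piece_apply_of_pos n M _ hyU]
    have hxy : x = y + unitVec (fine n M) μ := by rw [hy, sub_add_cancel]
    rcases Nat.lt_or_ge ((offsF n M y μ : ℕ) + 1) n with hlt | hge
    · have hb := (blockOf_offsF_add_of_lt n M y μ hlt).1
      rw [← hxy] at hb; exact absurd (hb ▸ hyU) hx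
    · have hl : (offsF n M y μ : ℕ) + 1 = n := le_antisymm (offsF n M y μ).isLt hge
      have hb := (blockOf_offsF_add_of_eq n M y μ hl).1
      rw [← hxy] at hb
      by_contra hf
      have hbump := bump_ne_zero_of_vfield_ne_zero n M hf
      have hlow := lower_of_bump_ne_zero_of_offs_last n M hn hbump hl
      obtain ⟨hS', hσ'⟩ := hU _ hyU.1 hlow ⟨hyU.2.1, hyU.2.2⟩
      exact hx (hb ▸ ⟨inPatch_add_of_lower M hyU.1 hlow, hS', hσ'⟩)
  · rw [piece_apply_of_neg n M _ hyU]

end Admissible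

/-! ## §2 Finite-overlap Cauchy–Schwarz -/

section Overlap

variable {ι m : Type*} [Fintype ι] [Fintype m]

/-- **FINITE OVERLAP**: if at every point at most the members of a set of size `≤ K` of the family `g_i` are non-zero, then
`‖Σ_i g_i‖² ≤ K·Σ_i ‖g_i‖²`. [folklore] -/
theorem nsq_sum_le_of_overlap (g : ι → m → ℂ) (T : m → Finset ι) (K : ℕ) (hT : ∀ x i, g i x ≠ 0 → i ∈ T x)
    (hK : ∀ x, (T x).card ≤ K) : nsq (∑ i, g i) ≤ K * ∑ i, nsq (g i) := by
  classical
  unfold nsq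
  calc ∑ x, ‖(∑ i, g i) x‖ ^ 2 ≤ ∑ x, ((K : ℝ) * ∑ i, ‖g i x‖ ^ 2) := Finset.sum_le_sum fun x _ => by
          have hsub : (∑ i, g i) x = ∑ i ∈ T x, g i x := by
            rw [Finset.sum_apply]
            exact (Finset.sum_subset (Finset.subset_univ _) fun i _ hi => by_contra fun h => hi (hT x i h)).symm
          rw [hsub]
          calc ‖∑ i ∈ T x, g i x‖ ^ 2 ≤ (∑ i ∈ T x, ‖g i x‖) ^ 2 := by
                gcongr; exact norm_sum_le _ _
            _ ≤ (T x).card * ∑ i ∈ T x, ‖g i x‖ ^ 2 := sq_sum_le_card_mul_sum_sq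
            _ ≤ K * ∑ i, ‖g i x‖ ^ 2 :=
                mul_le_mul (by exact_mod_cast hK x) (Finset.sum_le_univ_sum_of_nonneg fun i => by positivity)
                  (Finset.sum_nonneg fun i _ => by positivity) (Nat.cast_nonneg K)
    _ = K * ∑ i, ∑ x, ‖g i x‖ ^ 2 := by rw [← Finset.mul_sum, Finset.sum_comm]

omit [Fintype ι] in
/-- `Σ_i √a_i·√b_i ≤ √(Σ a_i)·√(Σ b_i)` for non-negative families (Cauchy–Schwarz). [folklore] -/
theorem sum_sqrt_mul_sqrt_le (s : Finset ι) {a b : ι → ℝ} (ha : ∀ i, 0 ≤ a i) (hb : ∀ i, 0 ≤ b i) :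
    ∑ i ∈ s, Real.sqrt (a i) * Real.sqrt (b i) ≤ Real.sqrt (∑ i ∈ s, a i) * Real.sqrt (∑ i ∈ s, b i) := by
  rw [← Real.sqrt_mul (Finset.sum_nonneg fun i _ => ha i)]
  refine Real.le_sqrt_of_sq_le ?_
  calc (∑ i ∈ s, Real.sqrt (a i) * Real.sqrt (b i)) ^ 2 ≤ (∑ i ∈ s, Real.sqrt (a i) ^ 2) * ∑ i ∈ s, Real.sqrt (b i) ^ 2 :=
        Finset.sum_mul_sq_le_sq_mul_sq s _ _
    _ = (∑ i ∈ s, a i) * ∑ i ∈ s, b i := by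
        rw [Finset.sum_congr rfl fun i _ => Real.sq_sqrt (ha i), Finset.sum_congr rfl fun i _ => Real.sq_sqrt (hb i)]

end Overlap

/-! ## §3 The vertices seen by a second difference -/

section Verts

variable (n : ℕ) [NeZero n] (M : Fin d → ℕ) [hM : ∀ μ, NeZero (M μ)]

open Classical in
/-- the `≤ 2^d` vertices of the block `b` (those whose patch contains `b`). [folklore] -/
def patchVerts (b : Tor M) : Finset (Tor M) := Finset.univ.filter fun v => InPatch M v b

/-- `card (patchVerts b) ≤ 2^d`. [folklore] -/
theorem card_patchVerts_le (b : Tor M) : (patchVerts M b).card ≤ 2 ^ d := by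
  classical
  have hsub : patchVerts M b ⊆ (Finset.univ : Finset (Fin d → Bool)).image fun τ ν => if τ ν then b ν + 1 else b ν := by
    intro v hv
    rw [patchVerts, Finset.mem_filter] at hv
    rw [Finset.mem_image]
    refine ⟨fun ν => decide (v ν = b ν + 1), Finset.mem_univ _, ?_⟩
    funext ν
    by_cases h' : v ν = b ν + 1
    · simp [h']
    · have h := (hv.2 ν).resolve_left h'
      simp [h]
  calc (patchVerts M b).card ≤ ((Finset.univ : Finset (Fin d → Bool)).image fun τ ν => if τ ν then b ν + 1 else b ν).card :=
        Finset.card_le_card hsub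
    _ ≤ (Finset.univ : Finset (Fin d → Bool)).card := Finset.card_image_le
    _ = 2 ^ d := by simp

/-- membership. [folklore] -/
theorem mem_patchVerts {v b : Tor M} (h : InPatch M v b) : v ∈ patchVerts M b := by
  classical
  rw [patchVerts, Finset.mem_filter]; exact ⟨Finset.mem_univ _, h⟩

/-- the vertices whose patch contains the block of `x`, `x + e_μ` or `x + 2e_μ`. [folklore] -/
def tripleVerts (μ : Fin d) (x : Tor (fine n M)) : Finset (Tor M) :=
  patchVerts M (blockOf n M x) ∪ patchVerts M (blockOf n M (x + unitVec (fine n M) μ))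
    ∪ patchVerts M (blockOf n M (x + unitVec (fine n M) μ + unitVec (fine n M) μ))

/-- `card (tripleVerts μ x) ≤ 3·2^d`. [folklore] -/
theorem card_tripleVerts_le (μ : Fin d) (x : Tor (fine n M)) : (tripleVerts n M μ x).card ≤ 3 * 2 ^ d := by
  unfold tripleVerts
  have h1 := card_patchVerts_le M (blockOf n M x)
  have h2 := card_patchVerts_le M (blockOf n M (x + unitVec (fine n M) μ))
  have h3 := card_patchVerts_le M (blockOf n M (x + unitVec (fine n M) μ + unitVec (fine n M) μ))
  calc _ ≤ (patchVerts M (blockOf n M x) ∪ patchVerts M (blockOf n M (x + unitVec (fine n M) μ))).card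
          + (patchVerts M (blockOf n M (x + unitVec (fine n M) μ + unitVec (fine n M) μ))).card := Finset.card_union_le _ _
    _ ≤ ((patchVerts M (blockOf n M x)).card + (patchVerts M (blockOf n M (x + unitVec (fine n M) μ))).card)
          + (patchVerts M (blockOf n M (x + unitVec (fine n M) μ + unitVec (fine n M) μ))).card :=
        add_le_add (Finset.card_union_le _ _) le_rfl
    _ ≤ 2 ^ d + 2 ^ d + 2 ^ d := by omega
    _ = 3 * 2 ^ d := by ring

/-- a second difference of the vertex field at `x` vanishes unless `v` is one of the `tripleVerts μ x`. [folklore] -/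
theorem mem_tripleVerts_of_ne_zero (c : ℂ) (μ : Fin d) {v : Tor M} {z : Tor (fine n M) → ℂ} {x : Tor (fine n M)}
    (h : (sdiff (fine n M) c μ *ᵥ (sdiff (fine n M) c μ *ᵥ vfield n M v z)) x ≠ 0) : v ∈ tripleVerts n M μ x := by
  unfold tripleVerts
  rw [Finset.mem_union, Finset.mem_union]
  simp only [sdiff_mulVec] at h
  by_cases h0 : vfield n M v z x ≠ 0
  · exact Or.inl (Or.inl (mem_patchVerts M (inPatch_of_bump_ne_zero n M (bump_ne_zero_of_vfield_ne_zero n M h0))))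
  by_cases h1 : vfield n M v z (x + unitVec (fine n M) μ) ≠ 0
  · exact Or.inl (Or.inr (mem_patchVerts M (inPatch_of_bump_ne_zero n M (bump_ne_zero_of_vfield_ne_zero n M h1))))
  by_cases h2 : vfield n M v z (x + unitVec (fine n M) μ + unitVec (fine n M) μ) ≠ 0
  · exact Or.inr (mem_patchVerts M (inPatch_of_bump_ne_zero n M (bump_ne_zero_of_vfield_ne_zero n M h2)))
  push Not at h0 h1 h2
  rw [h0, h1, h2] at h
  simp at h

end Verts

/-! ## §4 One vertex: the two admissible pieces -/

section Vertex

variable (n : ℕ) [NeZero n] (M : Fin d → ℕ) [hM : ∀ μ, NeZero (M μ)]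

/-- **ONE PIECE**: a propagating flag `P ⊆ S`, admissible for the translation `T_w` (`w = ±e_μ`) on its own blocks, costs
`‖∂_μ∂_μ (piece P f_v)‖² ≤ 2‖c‖·√E(f_v)·‖1_ΩΔf_v‖`. [folklore] -/
theorem nsq_sdiff_sdiff_piece_le {S : Tor M → Prop} {Ω : Tor (fine n M) → Prop} [DecidablePred Ω] (hΩ : ∀ x, Ω x ↔ S (blockOf n M x))
    (c : ℂ) (hc : c ≠ 0) (μ : Fin d) {P : Tor M → Prop} {v : Tor M} {z : Tor (fine n M) → ℂ} (hP : Propagates n M P v z)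
    (hPS : ∀ b, P b → S b) {w : Tor (fine n M)} (hw : w = unitVec (fine n M) μ ∨ w = -unitVec (fine n M) μ)
    (hadm : ∀ x, ¬ P (blockOf n M x) →
      (transS (fine n M) w (piece n M P (vfield n M v z)) - piece n M P (vfield n M v z)) x = 0) :
    nsq (sdiff (fine n M) c μ *ᵥ (sdiff (fine n M) c μ *ᵥ piece n M P (vfield n M v z)))
      ≤ 2 * ‖c‖ * Real.sqrt (energy (fine n M) c (vfield n M v z))
          * Real.sqrt (nsqOn Ω (LapS (fine n M) c *ᵥ vfield n M v z)) := by
  classical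
  set f := vfield n M v z with hf
  have hmain := nsq_sdiff_sdiff_le_of_admissible (fine n M) c hc μ hw (piece n M P f)
    (restrictTo (fun x => P (blockOf n M x)) (LapS (fine n M) c *ᵥ piece n M P f)) hadm (fun x hx => by simp [restrictTo, hx])
  refine hmain.trans ?_
  have hE : ∑ ν, nsq (sdiff (fine n M) c ν *ᵥ piece n M P f) ≤ energy (fine n M) c f :=
    Finset.sum_le_sum fun ν _ => nsq_mono (norm_sdiff_piece_le n M hP c ν)
  have hR : nsq (restrictTo (fun x => P (blockOf n M x)) (LapS (fine n M) c *ᵥ piece n M P f))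
      ≤ nsqOn Ω (LapS (fine n M) c *ᵥ f) := by
    rw [← nsq_restrictTo]
    refine nsq_mono fun x => ?_
    unfold restrictTo
    by_cases hx : P (blockOf n M x)
    · rw [if_pos hx, if_pos ((hΩ x).2 (hPS _ hx)), hf, LapS_piece_eq n M hP c hx]
    · rw [if_neg hx, norm_zero]; exact norm_nonneg _
  have h2c : 0 ≤ 2 * ‖c‖ := by positivity
  exact mul_le_mul (mul_le_mul_of_nonneg_left (Real.sqrt_le_sqrt hE) h2c) (Real.sqrt_le_sqrt hR) (Real.sqrt_nonneg _)
    (mul_nonneg h2c (Real.sqrt_nonneg _))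

/-- **ONE VERTEX**: if the patch of `v` is splittable along `μ`, the vertex field `f_v = bump_v·z` (any `z` supported in `Ω`) obeys
`‖∂_μ∂_μ f_v‖² ≤ 8‖c‖·√E(f_v)·‖1_ΩΔf_v‖` (`2 ≤ n`). [folklore] -/
theorem nsq_sdiff_sdiff_vfield_le (hn : 2 ≤ n) {S : Tor M → Prop} {Ω : Tor (fine n M) → Prop} [DecidablePred Ω]
    (hΩ : ∀ x, Ω x ↔ S (blockOf n M x)) (c : ℂ) (hc : c ≠ 0) {μ : Fin d} {v : Tor M} (hv : SplittableAt M S v μ)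
    {z : Tor (fine n M) → ℂ} (hz : ∀ x, ¬ Ω x → z x = 0) :
    nsq (sdiff (fine n M) c μ *ᵥ (sdiff (fine n M) c μ *ᵥ vfield n M v z))
      ≤ 8 * ‖c‖ * Real.sqrt (energy (fine n M) c (vfield n M v z))
          * Real.sqrt (nsqOn Ω (LapS (fine n M) c *ᵥ vfield n M v z)) := by
  obtain ⟨σ, hA, hD, hU⟩ := hv
  have hz' : ∀ x, ¬ S (blockOf n M x) → z x = 0 := fun x hx => hz x fun h => hx ((hΩ x).1 h)
  have hPD := nsq_sdiff_sdiff_piece_le n M hΩ c hc μ (propagates_flagD n M hA hz') (fun _ h => h.2.1) (Or.inl rfl)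
    (admissible_pieceD n M hD z)
  have hPU := nsq_sdiff_sdiff_piece_le n M hΩ c hc μ (propagates_flagU n M hA hz') (fun _ h => h.2.1) (Or.inr rfl)
    (admissible_pieceU n M hn hU z)
  have hsplit : sdiff (fine n M) c μ *ᵥ (sdiff (fine n M) c μ *ᵥ vfield n M v z)
      = sdiff (fine n M) c μ *ᵥ (sdiff (fine n M) c μ *ᵥ piece n M (flagD M S σ v) (vfield n M v z))
        + sdiff (fine n M) c μ *ᵥ (sdiff (fine n M) c μ *ᵥ piece n M (flagU M S σ v) (vfield n M v z)) := by
    rw [← Matrix.mulVec_add, ← Matrix.mulVec_add, piece_add_piece n M σ hz']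
  rw [hsplit]
  refine (nsq_add_le _ _).trans ?_
  linarith

end Vertex

end Summit.QuantumFields.BalabanUV.T4Continuum.DirichletSplitVertex

end
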